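import Summits.Ventures.PercRepro0.Defs

/-! # Events of Bernoulli bond percolation on ℤ^d: walks, monotonicity, measurability, θ(0), θ(1), p_c ∈ [0,1]

Lemmas about the objects of `Defs.lean` (PROVED-HERE, no literature; seat p5):

* `conn_iff_exists_walk`: `x ↔ y` in `ω` iff some lattice walk from `x` to `y` has all its edges in `ω`;
* monotonicity in `ω`: the events `{x ↔ y}`, `{0 ↔ ∂Λ_n}`, `{0 ↔ ∞}`, `{∃ infinite cluster}` are increasing (`IsUpperSet`);
* `box_finite`, `connInf_iff` (`x ↔ ∞` iff the cluster of `x` leaves every box);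
* measurability (F1 of ROUTE-v3) of `{x ↔ y}`, `{x ↔ ∞}`, `{0 ↔ ∞}`, `{0 ↔ ∂Λ_n}`, `{∃ infinite cluster}`, `{≤ 1 infinite cluster}`;
* `thetaI_zero`, `thetaI_one` (`d ≥ 1`), hence `pc_mem_Icc`: the §0 definition of `p_c(d)` hits no junk value;
* `theta_eq_zero_of_lt_pc`: `θ_d(p) = 0` for `0 ≤ p < p_c(d)` (`d ≥ 1`; no monotonicity needed).
-/
namespace Summit.Ventures.PercRepro0.Defs

open MeasureTheory ProbabilityTheory unitInterval Filter
open scoped ENNReal Topology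

variable {d : ℕ}

/-! ### The open graph sits inside the lattice; walks -/

/-- The open graph of any configuration is a subgraph of the lattice. -/
theorem openGraph_le (ω : Config d) : openGraph d ω ≤ lattice d := by
  intro x y h
  rw [openGraph, SimpleGraph.fromEdgeSet_adj] at h
  exact ((lattice d).mem_edgeSet).1 h.1.2

/-- With all bonds open, the open graph is the lattice. -/
theorem openGraph_bonds : openGraph d (bonds d) = lattice d := by
  rw [openGraph, Set.inter_self, bonds, SimpleGraph.fromEdgeSet_edgeSet]

/-- With no bond open, the open graph is empty. -/
theorem openGraph_empty : openGraph d ∅ = ⊥ := by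
  rw [openGraph, Set.empty_inter, SimpleGraph.fromEdgeSet_empty]

/-- `x ↔ y` in `ω` iff some walk of the lattice from `x` to `y` uses only bonds of `ω`. -/
theorem conn_iff_exists_walk (ω : Config d) (x y : Vertex d) :
    Conn d ω x y ↔ ∃ w : (lattice d).Walk x y, ∀ e ∈ w.edges, e ∈ ω := by
  constructor
  · rintro ⟨w⟩
    refine ⟨w.mapLe (openGraph_le ω), fun e he => ?_⟩
    rw [SimpleGraph.Walk.edges_mapLe_eq_edges] at he
    have h := w.edges_subset_edgeSet he
    rw [openGraph, SimpleGraph.edgeSet_fromEdgeSet] at h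
    exact h.1.1
  · rintro ⟨w, hw⟩
    refine ⟨w.transfer (openGraph d ω) fun e he => ?_⟩
    rw [openGraph, SimpleGraph.edgeSet_fromEdgeSet]
    exact ⟨⟨hw e he, w.edges_subset_edgeSet he⟩,
      SimpleGraph.not_isDiag_of_mem_edgeSet _ (w.edges_subset_edgeSet he)⟩

/-! ### Monotonicity in the configuration -/

/-- Opening more bonds enlarges the open graph. -/
theorem openGraph_mono {ω ω' : Config d} (h : ω ⊆ ω') : openGraph d ω ≤ openGraph d ω' :=
  SimpleGraph.fromEdgeSet_mono (Set.inter_subset_inter_left _ h)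

/-- Connections persist when more bonds are opened. -/
theorem conn_mono {ω ω' : Config d} (h : ω ⊆ ω') {x y : Vertex d} (hc : Conn d ω x y) :
    Conn d ω' x y :=
  hc.mono (openGraph_mono h)

/-- Clusters grow when more bonds are opened. -/
theorem cluster_mono {ω ω' : Config d} (h : ω ⊆ ω') (x : Vertex d) :
    cluster d ω x ⊆ cluster d ω' x :=
  fun _ hy => conn_mono h hy

/-- `x ↔ ∞` persists when more bonds are opened. -/
theorem connInf_mono {ω ω' : Config d} (h : ω ⊆ ω') {x : Vertex d} (hx : ConnInf d ω x) :
    ConnInf d ω' x :=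
  hx.mono (cluster_mono h x)

/-- `{0 ↔ ∞}` is an increasing event. -/
theorem isUpperSet_percolates : IsUpperSet (percolates d) :=
  fun _ _ h hω => connInf_mono h hω

/-- `{0 ↔ ∂Λ_n}` is an increasing event. -/
theorem isUpperSet_toBoundary (n : ℕ) : IsUpperSet (toBoundary d n) :=
  fun _ _ h ⟨y, hy, hc⟩ => ⟨y, hy, conn_mono h hc⟩

/-- `{x ↔ y}` is an increasing event. -/
theorem isUpperSet_conn (x y : Vertex d) : IsUpperSet {ω : Config d | Conn d ω x y} :=
  fun _ _ h hc => conn_mono h hc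

/-- `{∃ infinite cluster}` is an increasing event. -/
theorem isUpperSet_existsInfCluster : IsUpperSet (existsInfCluster d) :=
  fun _ _ h ⟨x, hx⟩ => ⟨x, connInf_mono h hx⟩

/-! ### Finite boxes and the characterisation of `x ↔ ∞` -/

/-- The box `Λ_n` is finite. -/
theorem box_finite (n : ℕ) : (box d n).Finite := by
  have : box d n = Set.pi Set.univ fun _ : Fin d => Set.Icc (-(n : ℤ)) n := by
    ext x
    simp only [box, Set.mem_setOf_eq, Set.mem_univ_pi, Set.mem_Icc, abs_le]
  rw [this]
  exact Set.Finite.pi fun _ => Set.finite_Icc _ _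

/-- `x ↔ ∞` iff the cluster of `x` leaves every box. -/
theorem connInf_iff (ω : Config d) (x : Vertex d) :
    ConnInf d ω x ↔ ∀ n : ℕ, ∃ y, y ∉ box d n ∧ Conn d ω x y := by
  constructor
  · intro h n
    by_contra hcon
    apply h
    refine (box_finite n).subset fun y hy => ?_
    by_contra hyb
    exact hcon ⟨y, hyb, hy⟩
  · intro h hfin
    obtain ⟨M, hM⟩ := (hfin.image fun y : Vertex d => ∑ i, |y i|).bddAbove
    obtain ⟨y, hy, hconn⟩ := h M.toNat
    apply hy
    intro i
    have h1 : ∑ j, |y j| ≤ M := hM ⟨y, hconn, rfl⟩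
    have h2 : |y i| ≤ ∑ j, |y j| :=
      Finset.single_le_sum (fun j _ => abs_nonneg (y j)) (Finset.mem_univ i)
    exact h2.trans (h1.trans (Int.self_le_toNat M))

/-! ### Measurability of the events -/

/-- `{x ↔ y}` is measurable. -/
theorem measurableSet_conn (x y : Vertex d) : MeasurableSet {ω : Config d | Conn d ω x y} := by
  have : {ω : Config d | Conn d ω x y} =
      ⋃ w : (lattice d).Walk x y, ⋂ e ∈ {e | e ∈ w.edges}, {ω : Config d | e ∈ ω} := by
    ext ω
    simp only [Set.mem_setOf_eq, Set.mem_iUnion, Set.mem_iInter, conn_iff_exists_walk]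
  rw [this]
  haveI : Countable ((lattice d).Walk x y) := SimpleGraph.Walk.support_injective.countable
  exact MeasurableSet.iUnion fun w =>
    MeasurableSet.biInter (Set.to_countable _) fun e _ => measurableSet_mem e

/-- `{x ↔ ∞}` is measurable. -/
theorem measurableSet_connInf (x : Vertex d) : MeasurableSet {ω : Config d | ConnInf d ω x} := by
  have : {ω : Config d | ConnInf d ω x} =
      ⋂ n : ℕ, ⋃ y ∈ {y : Vertex d | y ∉ box d n}, {ω : Config d | Conn d ω x y} := by
    ext ω
    simp only [Set.mem_setOf_eq, Set.mem_iInter, Set.mem_iUnion, connInf_iff, exists_prop]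
  rw [this]
  exact MeasurableSet.iInter fun n =>
    MeasurableSet.biUnion (Set.to_countable _) fun y _ => measurableSet_conn x y

/-- `{0 ↔ ∞}` is measurable. -/
theorem measurableSet_percolates : MeasurableSet (percolates d) :=
  measurableSet_connInf 0

/-- `{0 ↔ ∂Λ_n}` is measurable. -/
theorem measurableSet_toBoundary (n : ℕ) : MeasurableSet (toBoundary d n) := by
  have : toBoundary d n = ⋃ y ∈ boundary d n, {ω : Config d | Conn d ω 0 y} := by
    ext ω
    simp only [toBoundary, Set.mem_setOf_eq, Set.mem_iUnion, exists_prop]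
  rw [this]
  exact MeasurableSet.biUnion (Set.to_countable _) fun y _ => measurableSet_conn 0 y

/-- `{∃ infinite cluster}` is measurable. -/
theorem measurableSet_existsInfCluster : MeasurableSet (existsInfCluster d) := by
  have : existsInfCluster d = ⋃ x : Vertex d, {ω : Config d | ConnInf d ω x} := by
    ext ω
    simp only [existsInfCluster, Set.mem_setOf_eq, Set.mem_iUnion]
  rw [this]
  exact MeasurableSet.iUnion fun x => measurableSet_connInf x

/-- `{at most one infinite cluster}` is measurable. -/
theorem measurableSet_atMostOneInfCluster : MeasurableSet (atMostOneInfCluster d) := by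
  have : atMostOneInfCluster d = ⋂ x : Vertex d, ⋂ y : Vertex d,
      ({ω : Config d | ConnInf d ω x}ᶜ ∪ {ω : Config d | ConnInf d ω y}ᶜ ∪
        {ω : Config d | Conn d ω x y}) := by
    ext ω
    simp only [atMostOneInfCluster, Set.mem_setOf_eq, Set.mem_iInter, Set.mem_union,
      Set.mem_compl_iff]
    constructor
    · intro h x y
      by_cases hx : ConnInf d ω x
      · by_cases hy : ConnInf d ω y
        · exact Or.inr (h x y hx hy)
        · exact Or.inl (Or.inr hy)
      · exact Or.inl (Or.inl hx)
    · intro h x y hx hy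
      rcases h x y with (hx' | hy') | hc
      · exact absurd hx hx'
      · exact absurd hy hy'
      · exact hc
  rw [this]
  exact MeasurableSet.iInter fun x => MeasurableSet.iInter fun y =>
    ((measurableSet_connInf x).compl.union (measurableSet_connInf y).compl).union
      (measurableSet_conn x y)

/-! ### θ(0) = 0 and θ(1) = 1 -/

/-- In the empty configuration the cluster of `x` is `{x}`. -/
theorem cluster_empty (x : Vertex d) : cluster d (∅ : Config d) x = {x} := by
  ext y
  simp only [cluster, Set.mem_setOf_eq, Set.mem_singleton_iff, Conn, openGraph_empty,
    SimpleGraph.reachable_bot]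
  exact eq_comm

/-- The empty configuration does not percolate. -/
theorem empty_notMem_percolates : (∅ : Config d) ∉ percolates d := by
  show ¬ (cluster d ∅ 0).Infinite
  rw [cluster_empty]
  exact Set.not_infinite.2 (Set.finite_singleton 0)

/-- `θ_d(0) = 0`. -/
theorem thetaI_zero : thetaI d 0 = 0 := by
  unfold thetaI P
  rw [setBernoulli_zero, Measure.dirac_apply' _ measurableSet_percolates,
    Set.indicator_of_notMem empty_notMem_percolates]
  simp

/-- Moving one unit along a coordinate axis is a lattice step. -/
theorem lattice_adj_single (i : Fin d) (a : ℤ) :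
    (lattice d).Adj (Pi.single i a) (Pi.single i (a + 1)) := by
  show (∑ j, |(Pi.single i a : Vertex d) j - (Pi.single i (a + 1) : Vertex d) j|) = (1 : ℤ)
  have : ∀ j, |(Pi.single i a : Vertex d) j - (Pi.single i (a + 1) : Vertex d) j|
      = (Pi.single i (1 : ℤ) : Vertex d) j := by
    intro j
    by_cases hj : j = i
    · subst hj; simp
    · simp [hj]
  simp only [this]
  simp

/-- For `d ≥ 1`, the full lattice percolates: the cluster of `0` in `𝕃^d` is infinite. -/
theorem bonds_mem_percolates (hd : 1 ≤ d) : bonds d ∈ percolates d := by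
  show (cluster d (bonds d) 0).Infinite
  let i : Fin d := ⟨0, hd⟩
  have hreach : ∀ n : ℕ, (lattice d).Reachable 0 (Pi.single i (n : ℤ)) := by
    intro n
    induction n with
    | zero => simp
    | succ n ih =>
      refine ih.trans (SimpleGraph.Adj.reachable ?_)
      simpa using lattice_adj_single i (n : ℤ)
  refine Set.infinite_of_injective_forall_mem (f := fun n : ℕ => Pi.single i (n : ℤ)) ?_ ?_
  · intro a b hab
    exact Nat.cast_injective (Pi.single_injective i hab)
  · intro n
    show Conn d (bonds d) 0 (Pi.single i (n : ℤ))
    unfold Conn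
    rw [openGraph_bonds]
    exact hreach n

/-- `θ_d(1) = 1` for `d ≥ 1`. -/
theorem thetaI_one (hd : 1 ≤ d) : thetaI d 1 = 1 := by
  unfold thetaI P
  rw [setBernoulli_one, Measure.dirac_apply_of_mem (bonds_mem_percolates hd)]
  simp

/-- `clamp 1 = 1`. -/
theorem clamp_one : clamp 1 = 1 := by
  unfold clamp
  rw [Set.projIcc_right]
  rfl

/-- `clamp 0 = 0`. -/
theorem clamp_zero : clamp 0 = 0 := by
  unfold clamp
  rw [Set.projIcc_left]
  rfl

/-- `θ_d(1) = 1` on `ℝ`, for `d ≥ 1`. -/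
theorem theta_one (hd : 1 ≤ d) : theta d 1 = 1 := by
  rw [theta, clamp_one, thetaI_one hd]

/-- `θ_d(0) = 0` on `ℝ`. -/
theorem theta_zero : theta d 0 = 0 := by
  rw [theta, clamp_zero, thetaI_zero]

/-! ### `p_c(d) ∈ [0,1]` -/

/-- `p_c(d)` is the infimum of `pcSet d` (by definition). -/
theorem pc_eq_sInf_pcSet : pc d = sInf (pcSet d) := rfl

/-- `pcSet d` is bounded below by `0`. -/
theorem pcSet_bddBelow : BddBelow (pcSet d) := ⟨0, fun _ hp => hp.1.1⟩

/-- `1 ∈ pcSet d` for `d ≥ 1`. -/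
theorem one_mem_pcSet (hd : 1 ≤ d) : (1 : ℝ) ∈ pcSet d :=
  ⟨⟨zero_le_one, le_rfl⟩, by rw [theta_one hd]; exact one_pos⟩

/-- `0 ≤ p_c(d)`. -/
theorem pc_nonneg : 0 ≤ pc d :=
  Real.sInf_nonneg fun _ hp => hp.1.1

/-- `p_c(d) ≤ 1` for `d ≥ 1`. -/
theorem pc_le_one (hd : 1 ≤ d) : pc d ≤ 1 :=
  csInf_le pcSet_bddBelow (one_mem_pcSet hd)

/-- `p_c(d) ∈ [0,1]` for `d ≥ 1`: the §0 definition hits no junk value. -/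
theorem pc_mem_Icc (hd : 1 ≤ d) : pc d ∈ Set.Icc (0 : ℝ) 1 :=
  ⟨pc_nonneg, pc_le_one hd⟩

/-- Below `p_c(d)` the percolation probability vanishes (`d ≥ 1`; no monotonicity needed). -/
theorem theta_eq_zero_of_lt_pc (hd : 1 ≤ d) {p : ℝ} (hp0 : 0 ≤ p) (hp : p < pc d) :
    theta d p = 0 := by
  by_contra hne
  have hpos : 0 < theta d p := lt_of_le_of_ne (theta_nonneg d p) (Ne.symm hne)
  have hp1 : p ≤ 1 := hp.le.trans (pc_le_one hd)
  have : pc d ≤ p := csInf_le pcSet_bddBelow ⟨⟨hp0, hp1⟩, hpos⟩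
  exact absurd hp (not_lt.2 this)


end Summit.Ventures.PercRepro0.Defs
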